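/-
Copyright (c) 2026 the pub-hodgecm-mathlib formalisation cell (harness21).  Prover seat hodgecm-mathlib-K2Liu-p09 (g0): Track B «K2-LIT»,
#184♮ = hLiu418 = stmt-HodgeConjecture-24832, file #9 of the K2_Liu road (socket module
`Cruxes/HLiu418/Lines/K2_Liu_CurveThetaSigs_U3a_SiegelEisenstein.lean`), organ (III-b) step E5 → E5′; 2026-09-03.
-/
import Summits.HodgeConjecture.HodgeConjecture.Theorems.K2LiuSiegelDoubledUnfold                 -- ★ countable `H(L⁺)`, weights
import Summits.HodgeConjecture.HodgeConjecture.Theorems.K2LiuSiegelCharacterTrivialOnRational    -- ★ `modDelta_eq_one_of_mem_ratH`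
import Literature.NumberTheory.K2Lit.SiegelStandardSections                                     -- ★ `IwasawaDatum`
import Literature.NumberTheory.Automorphic.UnitaryGroupIwasawaIntegration                        -- ★ `HaarHK`, `isInvInvariant_of_compactSpace`
import Mathlib.Analysis.SpecialFunctions.Pow.Real
import HarnessLib

/-!
# Crux `HLiu418`, Track B road `K2_Liu`, unit U3a «SIEGEL EISENSTEIN SERIES», file #9 — helper 9 (organ (III-b), step E5 → E5′):
# the Siegel-domain integral on `H(𝔸)` is dominated by GODEMENT'S PARABOLIC INTEGRAL on `P_Δ(𝔸)` (the compact `K` integrated out)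

Cell `hodgecm-mathlib`, crux item hLiu418 = `stmt-HodgeConjecture-24832`, route of record `HCCMUnconditional`; squad K2 ∕ K2Liu,
prover K2Liu-p09 (g0).  THEOREMS ONLY (no `def`, no instance, no notation, no named-fact hypothesis, no `sorry`); lane
`--supports stmt-HodgeConjecture-24832` (count-neutral helper toward socket #9 `sig_K2LiuSiegelEisensteinDoubledSummable` ∕ #15b).

After ★ `K2LiuSiegelDoubledCountReduction.summable_height_rpow_of_lintegral_ne_top` (E2–E3), socket #15b hinges on the finiteness of
`∫⁻_{H(𝔸)} 1_{Φ ≤ C₀} Φ^τ β' dμ` for a `P_Δ(L⁺)`-covering weight `β'`.  This file integrates out the compact subgroup `K` of an Iwasawa datum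
`H(𝔸) = P_Δ(𝔸) · K` (★ `IwasawaDatum`, ★ socket «IWASAWA DATUM») with the tree's `H = P·K` integration formula (★ `HaarHK.eq_smul_map_prod`, the proved
second-countable Deitmar–Echterhoff 1.5.6), leaving GODEMENT'S PARABOLIC INTEGRAL on the closed subgroup `P_Δ(𝔸)` itself:

* §1 `isClosed_siegelDelta`; `modDelta_coe_eq` (`modDelta p = Φ(p)/Φ(1)` — so `modDelta` is measurable on `P_Δ(𝔸)` whenever `Φ` is);
  the rational Siegel elements `Γ_P = H(L⁺) ∩ P_Δ(𝔸)` act on `P_Δ(𝔸)` measurably, preserving a left Haar measure, fixing `modDelta`.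
* §2 **`exists_lintegral_eq_mul_lintegral_siegelDelta_lintegral`** — `∫⁻_H f = c ∫⁻_{P_Δ(𝔸)} ∫⁻_K f(p k) dμ_K dμ_P` for measurable `f ≥ 0`.
* §3 the `K`-average `w(p) = ∫⁻_K β'(p k) dμ_K` of a `P_Δ(L⁺)`-weight on `H(𝔸)` is a `Γ_P`-weight on `P_Δ(𝔸)` of mass `μ_K(K)` (Tonelli).
* §4 **`lintegral_siegelDomain_ne_top_of_parabolic`** — if for some left Haar `μ_P` on `P_Δ(𝔸)` and some `Γ_P`-covering weight `w₁`,
  `∫⁻_{P_Δ(𝔸)} 1_{modDelta ≤ C₁} modDelta^τ w₁ dμ_P < ∞` for every `C₁` (E5′: [Garrett2018, §3.10] «`∫_{Z_𝔸P_k\(Y ∩ P_𝔸)} |φ_s^o(p)| dp`»), then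
  `∫⁻_H 1_{Φ≤C₀} Φ^τ β' dμ < ∞` for EVERY `P_Δ(L⁺)`-weight `β'` and every `C₀` (weight independence ★ `lintegral_mul_eq_of_coveringSum_eq`).

HONEST LABEL.  Count-neutral helper of the K2_Liu road; it retires nothing by itself: `HC_CM` is proved only modulo the 7 printed
citations (2 remaining named inputs: hLiu418 = `stmt-HodgeConjecture-24832`, h413 = `stmt-HodgeConjecture-24833`) until rung 0 closes.

## References
* [Garrett2018] P. Garrett, *Modern Analysis of Automorphic Forms by Example* (2018), §3.10 (proof of Cor. 3.10.2).
* [DeitmarEchterhoff2014] A. Deitmar, S. Echterhoff, *Principles of Harmonic Analysis* (2014), Prop. 1.5.6.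
* [MoeglinWaldspurger1995] C. Mœglin, J.-L. Waldspurger, *Spectral Decomposition and Eisenstein Series* (1995), II.1.5.
* [Liu2021] Y. Liu, Camb. J. Math. 9 (2021), App. B §B.3 p. 101, Lem. B.10 (2).
-/

set_option autoImplicit false
-- the mandated namespace repeats the single-problem summit's segment (`HodgeConjecture.HodgeConjecture`)
set_option linter.dupNamespace false

noncomputable section

open scoped Matrix Pointwise ENNReal NNReal
open NumberField IsDedekindDomain MeasureTheory

namespace Summit.HodgeConjecture.HodgeConjecture.Cruxes.HLiu418.K2LiuSiegelDoubledParabolicReduction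

open Literature.NumberTheory.Automorphic Literature.NumberTheory.Automorphic.UnitaryGroup
open Literature.NumberTheory.GelbartRogawski1991 Literature.NumberTheory.GelbartRogawski1991.GRConstruction
open Literature.NumberTheory.K2Lit.SiegelDoubled
open Literature.MeasureTheory.Group
open Summit.HodgeConjecture.HodgeConjecture.Cruxes.HLiu418.K2LiuSiegelDoubledUnfold
open Summit.HodgeConjecture.HodgeConjecture.Cruxes.HLiu418.K2LiuSiegelCharacterTrivialOnRational

variable (L : Type) [Field L] [NumberField L] [IsCMField L]
variable {N M n : ℕ} (e : Fin N × Fin M ≃ Fin n)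
  (dV : Fin N → L) (hdV : ∀ i, IsCMField.complexConj L (dV i) = dV i)
  (dW : Fin M → L) (hdW : ∀ i, IsCMField.complexConj L (dW i) = dW i)

/-! ## §1 `P_Δ(𝔸)` is closed; `modDelta` through `Φ`; the rational Siegel elements acting on `P_Δ(𝔸)` -/

/-- `h ↦ blk h` (the `e₂`-block matrix of `h`) is continuous. [folklore] -/
theorem continuous_blk : Continuous fun h : HA L e dV hdV dW hdW => blk L e dV hdV dW hdW h :=
  (Units.continuous_val.comp continuous_subtype_val).matrix_submatrix _ _

/-- **`P_Δ(𝔸)` is a closed subgroup of `H(𝔸)`** (cut out by the continuous equation `h₁₁ + h₁₂ = h₂₁ + h₂₂`). [cite: Garrett2018, §3.10] -/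
theorem isClosed_siegelDelta : IsClosed ((siegelDelta L e dV hdV dW hdW : Subgroup (HA L e dV hdV dW hdW)) : Set (HA L e dV hdV dW hdW)) := by
  -- `𝔸_L` is Hausdorff (Mathlib instances on `L_∞ × 𝔸_L^∞`)
  haveI : T2Space (InfiniteAdeleRing L) := inferInstanceAs (T2Space ((v : InfinitePlace L) → v.Completion))
  haveI : T2Space (FiniteAdeleRing (𝓞 L) L) :=
    inferInstanceAs (T2Space (RestrictedProduct (fun v : HeightOneSpectrum (𝓞 L) => v.adicCompletion L)
      (fun v => (v.adicCompletionIntegers L : Set (v.adicCompletion L))) Filter.cofinite))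
  haveI : T2Space (AdeleRing (𝓞 L) L) := inferInstanceAs (T2Space (InfiniteAdeleRing L × FiniteAdeleRing (𝓞 L) L))
  have hc := continuous_blk L e dV hdV dW hdW
  have h11 : Continuous fun h : HA L e dV hdV dW hdW => (blk L e dV hdV dW hdW h).toBlocks₁₁ := hc.matrix_submatrix _ _
  have h12 : Continuous fun h : HA L e dV hdV dW hdW => (blk L e dV hdV dW hdW h).toBlocks₁₂ := hc.matrix_submatrix _ _
  have h21 : Continuous fun h : HA L e dV hdV dW hdW => (blk L e dV hdV dW hdW h).toBlocks₂₁ := hc.matrix_submatrix _ _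
  have h22 : Continuous fun h : HA L e dV hdV dW hdW => (blk L e dV hdV dW hdW h).toBlocks₂₂ := hc.matrix_submatrix _ _
  exact isClosed_eq (h11.add h12) (h21.add h22)

/-- On `P_Δ(𝔸)`, `modDelta p = Φ(p)/Φ(1)` for any height `Φ > 0` of type `(P_Δ, modDelta)`; in particular `modDelta` is measurable there
whenever `Φ` is. [cite: Garrett2018, §3.10] -/
theorem modDelta_eq_div {Φ : HA L e dV hdV dW hdW → ℝ} (hΦpos : ∀ x, 0 < Φ x)
    (hΦ : ∀ p x : HA L e dV hdV dW hdW, IsSiegelDelta L e dV hdV dW hdW p → Φ (p * x) = modDelta L e dV hdV dW hdW p * Φ x)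
    {p : HA L e dV hdV dW hdW} (hp : IsSiegelDelta L e dV hdV dW hdW p) :
    modDelta L e dV hdV dW hdW p = Φ p / Φ 1 := by
  rw [eq_div_iff (hΦpos 1).ne', ← hΦ p 1 hp, mul_one]

/-- Measurability of `modDelta` on `P_Δ(𝔸)` from a measurable height. [folklore] -/
theorem measurable_modDelta_coe [MeasurableSpace (HA L e dV hdV dW hdW)] [BorelSpace (HA L e dV hdV dW hdW)]
    {Φ : HA L e dV hdV dW hdW → ℝ} (hΦm : Measurable Φ) (hΦpos : ∀ x, 0 < Φ x)
    (hΦ : ∀ p x : HA L e dV hdV dW hdW, IsSiegelDelta L e dV hdV dW hdW p → Φ (p * x) = modDelta L e dV hdV dW hdW p * Φ x) :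
    Measurable fun p : (siegelDelta L e dV hdV dW hdW : Subgroup (HA L e dV hdV dW hdW)) =>
      modDelta L e dV hdV dW hdW (p : HA L e dV hdV dW hdW) := by
  have h : (fun p : (siegelDelta L e dV hdV dW hdW : Subgroup (HA L e dV hdV dW hdW)) =>
      modDelta L e dV hdV dW hdW (p : HA L e dV hdV dW hdW)) =
      fun p : (siegelDelta L e dV hdV dW hdW : Subgroup (HA L e dV hdV dW hdW)) => Φ (p : HA L e dV hdV dW hdW) / Φ 1 := by
    funext p; exact modDelta_eq_div L e dV hdV dW hdW hΦpos hΦ p.2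
  rw [h]
  exact (hΦm.comp measurable_subtype_coe).div_const _

/-- `modDelta` is invariant under LEFT multiplication by rational Siegel elements (`modDelta = 1` on `P_Δ(L⁺)`, ★ #10a). [cite: Liu2021, §B.3 p. 101] -/
theorem modDelta_rat_mul {δ p : HA L e dV hdV dW hdW} (hδ : IsSiegelDelta L e dV hdV dW hdW δ) (hδr : δ ∈ ratH L e dV hdV dW hdW)
    (hp : IsSiegelDelta L e dV hdV dW hdW p) :
    modDelta L e dV hdV dW hdW (δ * p) = modDelta L e dV hdV dW hdW p := by
  rw [modDelta_mul L e dV hdV dW hdW hδ hp, modDelta_eq_one_of_mem_ratH hδr, one_mul]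

/-! ## §2 `∫⁻_H f = c ∫⁻_{P_Δ(𝔸)} ∫⁻_K f(p k)` -/

section Iwasawa

variable [MeasurableSpace (HA L e dV hdV dW hdW)] [BorelSpace (HA L e dV hdV dW hdW)]

/-- **`∫⁻_{H(𝔸)} f = c · ∫⁻_{P_Δ(𝔸)} ∫⁻_K f(p k) dμ_K dμ_P`** for every measurable `f ≥ 0`, given an Iwasawa datum `H(𝔸) = P_Δ(𝔸) · K` and left Haar
measures (the `[0,∞]`-form of ★ `HaarHK.eq_smul_map_prod` — Deitmar–Echterhoff 1.5.6, proved second-countable version — at the closed subgroup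
`P_Δ(𝔸)`, via Tonelli and inversion invariance of `μ_K` on the compact group `K`, ★ `isInvInvariant_of_compactSpace`).
[cite: DeitmarEchterhoff2014, Prop. 1.5.6] [cite: Garrett2018, §3.10] -/
theorem exists_lintegral_eq_mul_lintegral_siegelDelta_lintegral (𝒦 : IwasawaDatum L e dV hdV dW hdW)
    (μG : Measure (HA L e dV hdV dW hdW)) [μG.IsHaarMeasure]
    (μP : Measure (siegelDelta L e dV hdV dW hdW : Subgroup (HA L e dV hdV dW hdW))) [μP.IsHaarMeasure]
    (μK : Measure 𝒦.K) [μK.IsHaarMeasure] :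
    ∃ C : ℝ≥0∞, C ≠ 0 ∧ C ≠ ∞ ∧ ∀ f : HA L e dV hdV dW hdW → ℝ≥0∞, Measurable f →
      ∫⁻ g, f g ∂μG = C * ∫⁻ p, ∫⁻ k, f ((p : HA L e dV hdV dW hdW) * (k : HA L e dV hdV dW hdW)) ∂μK ∂μP := by
  have hP : IsClosed ((siegelDelta L e dV hdV dW hdW : Subgroup (HA L e dV hdV dW hdW)) : Set (HA L e dV hdV dW hdW)) :=
    isClosed_siegelDelta L e dV hdV dW hdW
  have hK : IsCompact (𝒦.K : Set (HA L e dV hdV dW hdW)) := 𝒦.isCompact_K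
  have hPK : ∀ g : HA L e dV hdV dW hdW, ∃ p ∈ siegelDelta L e dV hdV dW hdW, ∃ k ∈ 𝒦.K, g = p * k := fun g => by
    obtain ⟨p, k, hp, hk, hg⟩ := 𝒦.iwasawa g
    exact ⟨p, (mem_siegelDelta_iff L e dV hdV dW hdW p).2 hp, k, hk, hg⟩
  haveI : CompactSpace 𝒦.K := isCompact_iff_compactSpace.1 hK
  haveI : LocallyCompactSpace (siegelDelta L e dV hdV dW hdW : Subgroup (HA L e dV hdV dW hdW)) := hP.locallyCompactSpace
  haveI : SecondCountableTopology (siegelDelta L e dV hdV dW hdW : Subgroup (HA L e dV hdV dW hdW)) :=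
    TopologicalSpace.Subtype.secondCountableTopology _
  haveI : SecondCountableTopology 𝒦.K := TopologicalSpace.Subtype.secondCountableTopology _
  haveI := isInvInvariant_of_compactSpace μK
  refine ⟨(HaarHK.decompConst hP hK hPK μG μP μK : ℝ≥0∞), ?_, ENNReal.coe_ne_top, fun f hf => ?_⟩
  · exact_mod_cast (HaarHK.decompConst_pos hP hK hPK μG μP μK).ne'
  · have hmeas : Measurable (HaarHK.hkMap (siegelDelta L e dV hdV dW hdW) 𝒦.K) := HaarHK.continuous_hkMap.measurable
    have hμ := HaarHK.eq_smul_map_prod hP hK hPK μG μP μK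
    calc ∫⁻ g, f g ∂μG
        = ∫⁻ g, f g ∂((HaarHK.decompConst hP hK hPK μG μP μK : ℝ≥0∞) •
            Measure.map (HaarHK.hkMap (siegelDelta L e dV hdV dW hdW) 𝒦.K) (μP.prod μK)) := by rw [← hμ]
      _ = (HaarHK.decompConst hP hK hPK μG μP μK : ℝ≥0∞) *
            ∫⁻ q, (fun q : ↥(siegelDelta L e dV hdV dW hdW) × ↥𝒦.K =>
              f (HaarHK.hkMap (siegelDelta L e dV hdV dW hdW) 𝒦.K q)) q ∂(μP.prod μK) := by
          rw [lintegral_smul_measure, lintegral_map hf hmeas, smul_eq_mul]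
      _ = (HaarHK.decompConst hP hK hPK μG μP μK : ℝ≥0∞) *
            ∫⁻ p, ∫⁻ k, f ((p : HA L e dV hdV dW hdW) * ((k : HA L e dV hdV dW hdW))⁻¹) ∂μK ∂μP := by
          rw [lintegral_prod (fun q : ↥(siegelDelta L e dV hdV dW hdW) × ↥𝒦.K =>
            f (HaarHK.hkMap (siegelDelta L e dV hdV dW hdW) 𝒦.K q)) (hf.comp hmeas).aemeasurable]
          rfl
      _ = (HaarHK.decompConst hP hK hPK μG μP μK : ℝ≥0∞) *
            ∫⁻ p, ∫⁻ k, f ((p : HA L e dV hdV dW hdW) * (k : HA L e dV hdV dW hdW)) ∂μK ∂μP := by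
          congr 1
          refine lintegral_congr fun p => ?_
          have hinv := lintegral_inv_eq_self (μ := μK)
            (fun k : 𝒦.K => f ((p : HA L e dV hdV dW hdW) * (k : HA L e dV hdV dW hdW)))
          simpa only [InvMemClass.coe_inv] using hinv

end Iwasawa

/-! ## §3 The rational Siegel elements `Γ_P` acting on `P_Δ(𝔸)`; the `K`-average of a weight -/

section Weights

variable [MeasurableSpace (HA L e dV hdV dW hdW)] [BorelSpace (HA L e dV hdV dW hdW)]

omit [MeasurableSpace (HA L e dV hdV dW hdW)] [BorelSpace (HA L e dV hdV dW hdW)] in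
/-- `Γ_P := H(L⁺) ∩ P_Δ(𝔸)` as a subgroup of `P_Δ(𝔸)` is countable. [folklore] -/
theorem countable_ratSiegel :
    Countable ((ratH L e dV hdV dW hdW).subgroupOf (siegelDelta L e dV hdV dW hdW)) := by
  haveI : Countable (ratH L e dV hdV dW hdW) := countable_ratH L e dV hdV dW hdW
  have hinj : Function.Injective fun δ : (ratH L e dV hdV dW hdW).subgroupOf (siegelDelta L e dV hdV dW hdW) =>
      (⟨((δ : (siegelDelta L e dV hdV dW hdW : Subgroup (HA L e dV hdV dW hdW))) : HA L e dV hdV dW hdW),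
        Subgroup.mem_subgroupOf.1 δ.2⟩ : ratH L e dV hdV dW hdW) := by
    intro a b h
    exact Subtype.ext (Subtype.ext (congrArg (fun z : ratH L e dV hdV dW hdW => (z : HA L e dV hdV dW hdW)) h))
  exact hinj.countable

omit [MeasurableSpace (HA L e dV hdV dW hdW)] [BorelSpace (HA L e dV hdV dW hdW)] in
/-- `Γ_P ≃ P_Δ(𝔸) ⊓ H(L⁺)` (the same elements, typed in `P_Δ(𝔸)` resp. in `H(𝔸)`). [folklore] -/
theorem exists_equiv_ratSiegel :
    ∃ ι : (ratH L e dV hdV dW hdW).subgroupOf (siegelDelta L e dV hdV dW hdW) ≃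
        (siegelDelta L e dV hdV dW hdW ⊓ ratH L e dV hdV dW hdW : Subgroup (HA L e dV hdV dW hdW)),
      ∀ δ, ((ι δ : (siegelDelta L e dV hdV dW hdW ⊓ ratH L e dV hdV dW hdW : Subgroup (HA L e dV hdV dW hdW))) :
        HA L e dV hdV dW hdW) = ((δ : (siegelDelta L e dV hdV dW hdW : Subgroup (HA L e dV hdV dW hdW))) : HA L e dV hdV dW hdW) :=
  ⟨{ toFun := fun δ => ⟨((δ : (siegelDelta L e dV hdV dW hdW : Subgroup (HA L e dV hdV dW hdW))) : HA L e dV hdV dW hdW),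
        Subgroup.mem_inf.2 ⟨δ.1.2, Subgroup.mem_subgroupOf.1 δ.2⟩⟩
     invFun := fun γ => ⟨⟨(γ : HA L e dV hdV dW hdW), (Subgroup.mem_inf.1 γ.2).1⟩,
        Subgroup.mem_subgroupOf.2 (Subgroup.mem_inf.1 γ.2).2⟩
     left_inv := fun _ => rfl
     right_inv := fun _ => rfl }, fun _ => rfl⟩

/-- **The `K`-average of a `P_Δ(L⁺)`-weight is a `Γ_P`-weight of mass `μ_K(K)` on `P_Δ(𝔸)`**: for a `P_Δ(L⁺)`-covering weight `β'` on `H(𝔸)` and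
`w(p) = ∫⁻_K β'(p k) dμ_K`, `Σ_{δ ∈ Γ_P} w(δ p) = μ_K(K)` (Tonelli). [cite: Garrett2018, §3.10] -/
theorem coveringSum_kAverage (𝒦 : IwasawaDatum L e dV hdV dW hdW) (μK : Measure 𝒦.K) [SFinite μK]
    {β' : HA L e dV hdV dW hdW → ℝ≥0∞}
    (hβ' : IsCoveringWeight (↥(siegelDelta L e dV hdV dW hdW ⊓ ratH L e dV hdV dW hdW)) β')
    (p : (siegelDelta L e dV hdV dW hdW : Subgroup (HA L e dV hdV dW hdW))) :
    coveringSum ((ratH L e dV hdV dW hdW).subgroupOf (siegelDelta L e dV hdV dW hdW))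
        (fun q : (siegelDelta L e dV hdV dW hdW : Subgroup (HA L e dV hdV dW hdW)) =>
          ∫⁻ k, β' ((q : HA L e dV hdV dW hdW) * (k : HA L e dV hdV dW hdW)) ∂μK) p = μK Set.univ := by
  haveI : Countable ((ratH L e dV hdV dW hdW).subgroupOf (siegelDelta L e dV hdV dW hdW)) := countable_ratSiegel L e dV hdV dW hdW
  obtain ⟨ι, hι⟩ := exists_equiv_ratSiegel L e dV hdV dW hdW
  rw [coveringSum_apply]
  have hmeas : ∀ δ : (ratH L e dV hdV dW hdW).subgroupOf (siegelDelta L e dV hdV dW hdW),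
      Measurable fun k : 𝒦.K => β' ((((δ • p : (siegelDelta L e dV hdV dW hdW : Subgroup (HA L e dV hdV dW hdW)))) :
        HA L e dV hdV dW hdW) * (k : HA L e dV hdV dW hdW)) := fun δ =>
    hβ'.1.comp ((continuous_const.mul continuous_subtype_val).measurable)
  rw [← lintegral_tsum fun δ => (hmeas δ).aemeasurable]
  have hpt : ∀ k : 𝒦.K, (∑' δ : (ratH L e dV hdV dW hdW).subgroupOf (siegelDelta L e dV hdV dW hdW),
      β' ((((δ • p : (siegelDelta L e dV hdV dW hdW : Subgroup (HA L e dV hdV dW hdW)))) : HA L e dV hdV dW hdW) *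
        (k : HA L e dV hdV dW hdW))) = 1 := by
    intro k
    have h1 := hβ'.2 ((p : HA L e dV hdV dW hdW) * (k : HA L e dV hdV dW hdW))
    rw [coveringSum_apply, ← Equiv.tsum_eq ι] at h1
    rw [← h1]
    refine tsum_congr fun δ => ?_
    show β' (((δ : (siegelDelta L e dV hdV dW hdW : Subgroup (HA L e dV hdV dW hdW))) : HA L e dV hdV dW hdW) *
      (p : HA L e dV hdV dW hdW) * (k : HA L e dV hdV dW hdW)) = β' (((ι δ : (siegelDelta L e dV hdV dW hdW ⊓ ratH L e dV hdV dW hdW :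
        Subgroup (HA L e dV hdV dW hdW))) : HA L e dV hdV dW hdW) * ((p : HA L e dV hdV dW hdW) * (k : HA L e dV hdV dW hdW)))
    rw [hι δ, mul_assoc]
  simp_rw [hpt]
  rw [lintegral_const, one_mul]

end Weights

/-! ## §4 E5 ⟸ E5′: the Siegel-domain integral on `H(𝔸)` from Godement's parabolic integral on `P_Δ(𝔸)` -/

/-- **THE SIEGEL-DOMAIN INTEGRAL FROM THE PARABOLIC INTEGRAL.**  Let `μ` be a left Haar measure on `H(𝔸)`, `𝒦` an Iwasawa datum,
`Φ > 0` a MEASURABLE height of type `(P_Δ, modDelta)` bounded above and below by positive constants on compacta, `τ ≥ 0`.  Suppose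
(E5′) that for some left Haar measure `μ_P` on `P_Δ(𝔸)` and some `Γ_P`-covering weight `w₁` on `P_Δ(𝔸)` the PARABOLIC INTEGRALS
`∫⁻_{P_Δ(𝔸)} 1_{modDelta ≤ C₁} · modDelta^τ · w₁ dμ_P` are finite for every `C₁`.  Then `∫⁻_{H(𝔸)} 1_{Φ ≤ C₀} · Φ^τ · β' dμ < ∞` for every
`P_Δ(L⁺)`-covering weight `β'` on `H(𝔸)` and every `C₀` — the hypothesis E5 of ★ `summable_height_rpow_of_lintegral_ne_top`.
Proof: `∫⁻_H = c ∫⁻_P ∫⁻_K` (§2); on `p k`, `Φ(pk) = modDelta(p) Φ(k)` with `c_K ≤ Φ(k) ≤ C_K`; the `K`-integral of `β'(p ·)` is a `Γ_P`-weight of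
mass `μ_K(K)` (§3), exchanged for `μ_K(K) · w₁` by ★ `lintegral_mul_eq_of_coveringSum_eq`.
[cite: Garrett2018, §3.10 (proof of Cor. 3.10.2)] [cite: MoeglinWaldspurger1995, II.1.5] [cite: DeitmarEchterhoff2014, Prop. 1.5.6] -/
theorem lintegral_siegelDomain_ne_top_of_parabolic [MeasurableSpace (HA L e dV hdV dW hdW)] [BorelSpace (HA L e dV hdV dW hdW)]
    (μ : Measure (HA L e dV hdV dW hdW)) [μ.IsHaarMeasure] (𝒦 : IwasawaDatum L e dV hdV dW hdW)
    {Φ : HA L e dV hdV dW hdW → ℝ} (hΦm : Measurable Φ) (hΦpos : ∀ x, 0 < Φ x)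
    (hΦ : ∀ p x : HA L e dV hdV dW hdW, IsSiegelDelta L e dV hdV dW hdW p → Φ (p * x) = modDelta L e dV hdV dW hdW p * Φ x)
    (hΦK : ∀ K : Set (HA L e dV hdV dW hdW), IsCompact K → ∃ c : ℝ, 0 < c ∧ ∀ k ∈ K, c ≤ Φ k)
    (hΦup : ∀ K : Set (HA L e dV hdV dW hdW), IsCompact K → ∃ C : ℝ, ∀ k ∈ K, Φ k ≤ C)
    {τ : ℝ} (hτ : 0 ≤ τ)
    (μP : Measure (siegelDelta L e dV hdV dW hdW : Subgroup (HA L e dV hdV dW hdW))) [μP.IsHaarMeasure]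
    {w₁ : ↥(siegelDelta L e dV hdV dW hdW) → ℝ≥0∞}
    (hw₁ : IsCoveringWeight (↥((ratH L e dV hdV dW hdW).subgroupOf (siegelDelta L e dV hdV dW hdW))) w₁)
    (hE5' : ∀ C₁ : ℝ, ∫⁻ p, {p : ↥(siegelDelta L e dV hdV dW hdW) |
        modDelta L e dV hdV dW hdW (p : HA L e dV hdV dW hdW) ≤ C₁}.indicator
          (fun p => ENNReal.ofReal (modDelta L e dV hdV dW hdW (p : HA L e dV hdV dW hdW) ^ τ)) p * w₁ p ∂μP ≠ ∞)
    {β' : HA L e dV hdV dW hdW → ℝ≥0∞}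
    (hβ' : IsCoveringWeight (↥(siegelDelta L e dV hdV dW hdW ⊓ ratH L e dV hdV dW hdW)) β') (C₀ : ℝ) :
    ∫⁻ x, {x | Φ x ≤ C₀}.indicator (fun x => ENNReal.ofReal (Φ x ^ τ)) x * β' x ∂μ ≠ ∞ := by
  classical
  haveI : Countable ((ratH L e dV hdV dW hdW).subgroupOf (siegelDelta L e dV hdV dW hdW)) := countable_ratSiegel L e dV hdV dW hdW
  -- instances on `K` and `(siegelDelta L e dV hdV dW hdW)`
  have hKc : IsCompact (𝒦.K : Set (HA L e dV hdV dW hdW)) := 𝒦.isCompact_K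
  haveI : CompactSpace 𝒦.K := isCompact_iff_compactSpace.1 hKc
  haveI : SecondCountableTopology 𝒦.K := TopologicalSpace.Subtype.secondCountableTopology _
  haveI : SecondCountableTopology (siegelDelta L e dV hdV dW hdW) := TopologicalSpace.Subtype.secondCountableTopology _
  haveI : LocallyCompactSpace (siegelDelta L e dV hdV dW hdW) := (isClosed_siegelDelta L e dV hdV dW hdW).locallyCompactSpace
  haveI : Nonempty 𝒦.K := ⟨1⟩
  -- a Haar measure on `K` (compact group: finite total mass)
  set μK : Measure 𝒦.K := Measure.haarMeasure (⟨⟨Set.univ, isCompact_univ⟩, by simp⟩ : TopologicalSpace.PositiveCompacts 𝒦.K) with hμK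
  have hμKtop : μK Set.univ ≠ ∞ := (IsCompact.measure_lt_top isCompact_univ).ne
  have hμK0 : μK Set.univ ≠ 0 := isOpen_univ.measure_ne_zero μK Set.univ_nonempty
  -- §2: `∫⁻_H = c ∫⁻_P ∫⁻_K`
  obtain ⟨C, hC0, hCtop, hHK⟩ := exists_lintegral_eq_mul_lintegral_siegelDelta_lintegral L e dV hdV dW hdW 𝒦 μ μP μK
  -- bounds of `Φ` on `K`
  obtain ⟨cK, hcK, hcKle⟩ := hΦK _ hKc
  obtain ⟨CK, hCKle⟩ := hΦup _ hKc
  have hCK : 0 ≤ CK := (hΦpos 1).le.trans (hCKle 1 𝒦.K.one_mem)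
  -- the integrand and its measurability
  set F : HA L e dV hdV dW hdW → ℝ≥0∞ := fun x => {x | Φ x ≤ C₀}.indicator (fun x => ENNReal.ofReal (Φ x ^ τ)) x * β' x with hF
  have hFm : Measurable F :=
    ((hΦm.pow_const τ).ennreal_ofReal.indicator (measurableSet_le hΦm measurable_const)).mul hβ'.1
  -- the parabolic majorant `g(p) = 1_{modDelta p ≤ C₀/c_K} modDelta(p)^τ`
  set C₁ : ℝ := C₀ / cK with hC₁
  set g : (siegelDelta L e dV hdV dW hdW) → ℝ≥0∞ := fun p => {p : (siegelDelta L e dV hdV dW hdW) | modDelta L e dV hdV dW hdW (p : HA L e dV hdV dW hdW) ≤ C₁}.indicator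
    (fun p => ENNReal.ofReal (modDelta L e dV hdV dW hdW (p : HA L e dV hdV dW hdW) ^ τ)) p with hg
  have hmodm : Measurable fun p : (siegelDelta L e dV hdV dW hdW) => modDelta L e dV hdV dW hdW (p : HA L e dV hdV dW hdW) :=
    measurable_modDelta_coe L e dV hdV dW hdW hΦm hΦpos hΦ
  have hgm : Measurable g := (hmodm.pow_const τ).ennreal_ofReal.indicator (measurableSet_le hmodm measurable_const)
  -- pointwise domination on `p k`
  have hpt : ∀ (p : (siegelDelta L e dV hdV dW hdW)) (k : 𝒦.K), F ((p : HA L e dV hdV dW hdW) * (k : HA L e dV hdV dW hdW)) ≤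
      ENNReal.ofReal (CK ^ τ) * g p * β' ((p : HA L e dV hdV dW hdW) * (k : HA L e dV hdV dW hdW)) := by
    intro p k
    have hp : IsSiegelDelta L e dV hdV dW hdW (p : HA L e dV hdV dW hdW) := (mem_siegelDelta_iff L e dV hdV dW hdW _).1 p.2
    have hmod : 0 < modDelta L e dV hdV dW hdW (p : HA L e dV hdV dW hdW) := modDelta_pos L e dV hdV dW hdW _
    have hΦpk : Φ ((p : HA L e dV hdV dW hdW) * (k : HA L e dV hdV dW hdW)) =
        modDelta L e dV hdV dW hdW (p : HA L e dV hdV dW hdW) * Φ (k : HA L e dV hdV dW hdW) := hΦ _ _ hp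
    rw [hF]
    dsimp only
    refine mul_le_mul' ?_ le_rfl
    by_cases hle : Φ ((p : HA L e dV hdV dW hdW) * (k : HA L e dV hdV dW hdW)) ≤ C₀
    · rw [Set.indicator_of_mem (show _ ∈ {x | Φ x ≤ C₀} from hle)]
      -- `modDelta p ≤ C₀ / c_K`
      have hk1 : cK ≤ Φ (k : HA L e dV hdV dW hdW) := hcKle _ k.2
      have hmodle : modDelta L e dV hdV dW hdW (p : HA L e dV hdV dW hdW) ≤ C₁ := by
        rw [hC₁, le_div_iff₀ hcK]
        calc modDelta L e dV hdV dW hdW (p : HA L e dV hdV dW hdW) * cK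
            ≤ modDelta L e dV hdV dW hdW (p : HA L e dV hdV dW hdW) * Φ (k : HA L e dV hdV dW hdW) :=
              mul_le_mul_of_nonneg_left hk1 hmod.le
          _ ≤ C₀ := by rw [← hΦpk]; exact hle
      rw [hg]
      dsimp only
      rw [Set.indicator_of_mem (show p ∈ {p : (siegelDelta L e dV hdV dW hdW) | modDelta L e dV hdV dW hdW (p : HA L e dV hdV dW hdW) ≤ C₁} from hmodle),
        ← ENNReal.ofReal_mul (Real.rpow_nonneg hCK τ), hΦpk,
        Real.mul_rpow hmod.le (hΦpos _).le, mul_comm (CK ^ τ)]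
      exact ENNReal.ofReal_le_ofReal (mul_le_mul_of_nonneg_left
        (Real.rpow_le_rpow (hΦpos _).le (hCKle _ k.2) hτ) (Real.rpow_nonneg hmod.le τ))
    · rw [Set.indicator_of_notMem (show _ ∉ {x | Φ x ≤ C₀} from hle)]
      exact bot_le
  -- integrate over `K`: `∫⁻_K F(p k) ≤ ofReal(C_K^τ) · g(p) · w(p)`
  set w : (siegelDelta L e dV hdV dW hdW) → ℝ≥0∞ := fun p => ∫⁻ k, β' ((p : HA L e dV hdV dW hdW) * (k : HA L e dV hdV dW hdW)) ∂μK with hw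
  have hK_le : ∀ p : (siegelDelta L e dV hdV dW hdW), ∫⁻ k, F ((p : HA L e dV hdV dW hdW) * (k : HA L e dV hdV dW hdW)) ∂μK ≤
      ENNReal.ofReal (CK ^ τ) * g p * w p := by
    intro p
    calc ∫⁻ k, F ((p : HA L e dV hdV dW hdW) * (k : HA L e dV hdV dW hdW)) ∂μK
        ≤ ∫⁻ k, ENNReal.ofReal (CK ^ τ) * g p * β' ((p : HA L e dV hdV dW hdW) * (k : HA L e dV hdV dW hdW)) ∂μK :=
          lintegral_mono fun k => hpt p k
      _ = ENNReal.ofReal (CK ^ τ) * g p * w p := by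
          rw [hw, lintegral_const_mul' _ _ (ENNReal.mul_ne_top ENNReal.ofReal_ne_top (by
            rw [hg]; dsimp only
            exact ne_top_of_le_ne_top ENNReal.ofReal_ne_top (Set.indicator_le_self _ _ p)))]
  -- `w` is a `Γ_P`-weight of mass `μ_K(K)`; exchange it for `μ_K(K) · w₁`
  have hwm : Measurable w := by
    rw [hw]
    refine Measurable.lintegral_prod_right ?_
    exact hβ'.1.comp ((continuous_subtype_val.comp continuous_fst).mul (continuous_subtype_val.comp continuous_snd)).measurable
  haveI : MeasurableConstSMul ((ratH L e dV hdV dW hdW).subgroupOf (siegelDelta L e dV hdV dW hdW)) (siegelDelta L e dV hdV dW hdW) := ⟨fun δ => measurable_const_mul (δ : (siegelDelta L e dV hdV dW hdW))⟩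
  haveI : SMulInvariantMeasure ((ratH L e dV hdV dW hdW).subgroupOf (siegelDelta L e dV hdV dW hdW)) (siegelDelta L e dV hdV dW hdW) μP :=
    ⟨fun δ s _hs => by
      rw [show (fun x : (siegelDelta L e dV hdV dW hdW) => δ • x) ⁻¹' s = (fun x : (siegelDelta L e dV hdV dW hdW) => ((δ : (siegelDelta L e dV hdV dW hdW))) * x) ⁻¹' s from rfl, measure_preimage_mul]⟩
  have hginv : ∀ (δ : ((ratH L e dV hdV dW hdW).subgroupOf (siegelDelta L e dV hdV dW hdW))) (p : (siegelDelta L e dV hdV dW hdW)), g (δ • p) = g p := by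
    intro δ p
    have hδP : IsSiegelDelta L e dV hdV dW hdW (((δ : (siegelDelta L e dV hdV dW hdW))) : HA L e dV hdV dW hdW) := (mem_siegelDelta_iff L e dV hdV dW hdW _).1 (δ : (siegelDelta L e dV hdV dW hdW)).2
    have hδr : (((δ : (siegelDelta L e dV hdV dW hdW))) : HA L e dV hdV dW hdW) ∈ ratH L e dV hdV dW hdW := Subgroup.mem_subgroupOf.1 δ.2
    have hp : IsSiegelDelta L e dV hdV dW hdW (p : HA L e dV hdV dW hdW) := (mem_siegelDelta_iff L e dV hdV dW hdW _).1 p.2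
    have hmd : modDelta L e dV hdV dW hdW (((δ • p : (siegelDelta L e dV hdV dW hdW))) : HA L e dV hdV dW hdW) = modDelta L e dV hdV dW hdW (p : HA L e dV hdV dW hdW) :=
      modDelta_rat_mul L e dV hdV dW hdW hδP hδr hp
    rw [hg]; dsimp only
    simp only [Set.indicator_apply, Set.mem_setOf_eq, hmd]
  have hwsum : ∀ p : (siegelDelta L e dV hdV dW hdW), coveringSum ((ratH L e dV hdV dW hdW).subgroupOf (siegelDelta L e dV hdV dW hdW)) w p = μK Set.univ := fun p =>
    coveringSum_kAverage L e dV hdV dW hdW 𝒦 μK hβ' p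
  have hw₁sum : ∀ p : (siegelDelta L e dV hdV dW hdW), coveringSum ((ratH L e dV hdV dW hdW).subgroupOf (siegelDelta L e dV hdV dW hdW)) (fun q => μK Set.univ * w₁ q) p = μK Set.univ := fun p => by
    rw [coveringSum_const_mul, hw₁.2 p, mul_one]
  have hexch : ∫⁻ p, g p * w p ∂μP = ∫⁻ p, g p * (μK Set.univ * w₁ p) ∂μP :=
    lintegral_mul_eq_of_coveringSum_eq μP hgm hginv hwm (hw₁.1.const_mul _) hμK0 hμKtop hwsum hw₁sum
  -- assemble
  rw [hHK F hFm]
  refine ENNReal.mul_ne_top hCtop (ne_top_of_le_ne_top ?_ (lintegral_mono hK_le))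
  have hsplit : ∫⁻ p, ENNReal.ofReal (CK ^ τ) * g p * w p ∂μP = ENNReal.ofReal (CK ^ τ) * (μK Set.univ *
      ∫⁻ p, g p * w₁ p ∂μP) := by
    simp_rw [mul_assoc]
    rw [lintegral_const_mul' _ _ ENNReal.ofReal_ne_top, hexch]
    simp_rw [← mul_assoc, mul_comm (g _) (μK Set.univ), mul_assoc]
    rw [lintegral_const_mul' _ _ hμKtop]
  rw [hsplit]
  exact ENNReal.mul_ne_top ENNReal.ofReal_ne_top (ENNReal.mul_ne_top hμKtop (hE5' C₁))

end Summit.HodgeConjecture.HodgeConjecture.Cruxes.HLiu418.K2LiuSiegelDoubledParabolicReduction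

end
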